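import Literature.GroupTheory.CombinatorialGroupTheory.FoxPathChains
import Mathlib.Algebra.BigOperators.Intervals
import Mathlib.GroupTheory.OrderOfElement
import HarnessLib

/-!
# The norm element of a cyclic subgroup acting on `k[G]`: `ker(N_q ·) = (1 - q)·k[G]` and `Fix(q ·) = N_q·k[G]`

K. S. Brown, *Cohomology of Groups*, GTM 87 (1982), Ch. I §6, (6.3): for a finite cyclic group `⟨t⟩` of
order `n` the «norm element» `N = 1 + t + ⋯ + t^{n-1}` of `ℤ⟨t⟩` gives the exact periodic resolution
`⋯ → ℤG —(t-1)→ ℤG —N→ ℤG —(t-1)→ ℤG → ℤ → 0`, i.e. `ker N = im (t - 1)` and `ker (t - 1) = im N`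
[cite: Brown1982CohomologyGroups, Ch. I §6 (6.3)].

Topic `Literature/GroupTheory/CombinatorialGroupTheory`; classical, self-contained (one definition pair, proofs).
We prove the two identities in the generality used by Fox-calculus arguments in finite quotients: `G` is ANY
group, `q ∈ G` an element of FINITE ORDER `o`, and `⟨q⟩` acts on the coefficient functions `G → k` (`k` any
additive commutative group; for finite `G` these are the elements of the group ring `k[G]`) by the left and
right translations `FoxChain.lt g f = (x ↦ f (g⁻¹ x))` (`= g · f`) and `FoxChain.rt h f = (x ↦ f (x h⁻¹))`
(`= f · h`) of `FoxPathChains.lean` — the vocabulary of the level Fox chains `FoxLevel.alpha / beta`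
(`Literature/AnabelianGeometry/EtaleTheta/SettingModelFoxLevelMaps.lean`, where `α_{w^j} = Σ_{i<j} λ_{π(w)^i} α_w`).

* `FoxChain.normL q f = Σ_{i<o} λ_{q^i} f` (`= N_q · f`) and `FoxChain.normR q f = Σ_{i<o} ρ_{q^i} f` (`= f · N_q`);
  `lt_normL`, `normL_lt`, `rt_normR`, `normR_rt` (`q N_q = N_q = N_q q`), `normL_sub_lt_self`
  (`N_q (γ - q γ) = 0`), `normR_sub_rt_self`;
* **`FoxChain.normL_eq_zero_iff`** — `N_q · f = 0 ↔ f = γ - q·γ` for some `γ` (`ker(N_q ·) = (1 - q) k[G]`);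
* **`FoxChain.lt_eq_self_iff`** — `q · f = f ↔ f = N_q · γ` for some `γ` (`Fix(q ·) = N_q k[G]`);
* the right-handed twins **`FoxChain.normR_eq_zero_iff`** (`f · N_q = 0 ↔ f = γ - γ·q`) and
  **`FoxChain.rt_eq_self_iff`** (`f · q = f ↔ f = γ · N_q`), transported through `Gᵐᵒᵖ`.
Proof: `G` is the disjoint union of the cosets `⟨q⟩x`, on each of which `f` is a `o`-periodic sequence; a
sequence with vanishing cyclic sum is a cyclic difference of its partial sums, and a shift-invariant sequence is
constant (a representative per coset is chosen with `Classical.epsilon`; no finiteness of `G` is needed).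
Serves the abc-iut cell's programme P-L2 (rung (L2-T), leaf (Gr): a-balanced chains, the orbit criterion);
nothing here bears on [IUTchIII] Cor. 3.12.
-/

namespace Literature.GroupTheory.CombinatorialGroupTheory.FoxChain

variable {G : Type*} [Group G] {k : Type*} [AddCommGroup k]

/-! ### The norm operators -/

/-- **`N_q · f`**: the left norm operator `Σ_{i < o} λ_{q^i} f` of an element `q` of order `o`
(`(N_q · f)(x) = Σ_{i<o} f (q^{-i} x)`; the zero map if `q` has infinite order).
[cite: Brown1982CohomologyGroups, Ch. I §6 (6.3)] -/
noncomputable def normL (q : G) (f : G → k) : G → k := ∑ i ∈ Finset.range (orderOf q), lt (q ^ i) f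

/-- **`f · N_q`**: the right norm operator `Σ_{i < o} ρ_{q^i} f` (`(f · N_q)(x) = Σ_{i<o} f (x q^{-i})`).
[cite: Brown1982CohomologyGroups, Ch. I §6 (6.3)] -/
noncomputable def normR (q : G) (f : G → k) : G → k := ∑ i ∈ Finset.range (orderOf q), rt (q ^ i) f

/-- `(N_q · f)(x) = Σ_{i<o} f (q^{-i} x)`. [cite: Brown1982CohomologyGroups, Ch. I §6 (6.3)] -/
theorem normL_apply (q : G) (f : G → k) (x : G) :
    normL q f x = ∑ i ∈ Finset.range (orderOf q), f ((q ^ i)⁻¹ * x) := by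
  simp only [normL, Finset.sum_apply, lt_apply]

/-- `(f · N_q)(x) = Σ_{i<o} f (x q^{-i})`. [cite: Brown1982CohomologyGroups, Ch. I §6 (6.3)] -/
theorem normR_apply (q : G) (f : G → k) (x : G) :
    normR q f x = ∑ i ∈ Finset.range (orderOf q), f (x * (q ^ i)⁻¹) := by
  simp only [normR, Finset.sum_apply, rt_apply]

/-- The index shift `Σ_{i<o} F(q^{i+1}) = Σ_{i<o} F(q^i)` behind `q N_q = N_q` (`q^o = q^0`). [folklore] -/
private theorem sum_range_orderOf_pow_succ {M : Type*} [AddCommGroup M] (q : G) (F : G → M) :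
    ∑ i ∈ Finset.range (orderOf q), F (q ^ (i + 1)) = ∑ i ∈ Finset.range (orderOf q), F (q ^ i) := by
  have h := (Finset.sum_range_succ' (fun i => F (q ^ i)) (orderOf q)).symm.trans
    (Finset.sum_range_succ (fun i => F (q ^ i)) (orderOf q))
  simp only [pow_orderOf_eq_one, pow_zero] at h
  exact add_right_cancel h

/-- `q · (N_q · f) = N_q · f`. [cite: Brown1982CohomologyGroups, Ch. I §6 (6.3)] -/
theorem lt_normL (q : G) (f : G → k) : lt q (normL q f) = normL q f := by
  simp only [normL, lt_sum, ← lt_mul, ← pow_succ']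
  exact sum_range_orderOf_pow_succ q fun g => lt g f

/-- `N_q · (q · f) = N_q · f`. [cite: Brown1982CohomologyGroups, Ch. I §6 (6.3)] -/
theorem normL_lt (q : G) (f : G → k) : normL q (lt q f) = normL q f := by
  simp only [normL, ← lt_mul, ← pow_succ]
  exact sum_range_orderOf_pow_succ q fun g => lt g f

/-- `(f · N_q) · q = f · N_q`. [cite: Brown1982CohomologyGroups, Ch. I §6 (6.3)] -/
theorem rt_normR (q : G) (f : G → k) : rt q (normR q f) = normR q f := by
  simp only [normR, rt_sum, ← rt_mul, ← pow_succ]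
  exact sum_range_orderOf_pow_succ q fun g => rt g f

/-- `(f · q) · N_q = f · N_q`. [cite: Brown1982CohomologyGroups, Ch. I §6 (6.3)] -/
theorem normR_rt (q : G) (f : G → k) : normR q (rt q f) = normR q f := by
  simp only [normR, ← rt_mul, ← pow_succ']
  exact sum_range_orderOf_pow_succ q fun g => rt g f

/-- `N_q ·` commutes with subtraction. [cite: Brown1982CohomologyGroups, Ch. I §6 (6.3)] -/
theorem normL_sub (q : G) (f f' : G → k) : normL q (f - f') = normL q f - normL q f' := by
  simp only [normL, lt_sub, Finset.sum_sub_distrib]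

/-- `· N_q` commutes with subtraction. [cite: Brown1982CohomologyGroups, Ch. I §6 (6.3)] -/
theorem normR_sub (q : G) (f f' : G → k) : normR q (f - f') = normR q f - normR q f' := by
  simp only [normR, rt_sub, Finset.sum_sub_distrib]

/-- `N_q · (γ - q·γ) = 0` (`N_q (1 - q) = 0`). [cite: Brown1982CohomologyGroups, Ch. I §6 (6.3)] -/
theorem normL_sub_lt_self (q : G) (γ : G → k) : normL q (γ - lt q γ) = 0 := by
  rw [normL_sub, normL_lt, sub_self]

/-- `(γ - γ·q) · N_q = 0` (`(1 - q) N_q = 0`). [cite: Brown1982CohomologyGroups, Ch. I §6 (6.3)] -/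
theorem normR_sub_rt_self (q : G) (γ : G → k) : normR q (γ - rt q γ) = 0 := by
  rw [normR_sub, normR_rt, sub_self]

/-! ### Coset representatives for `⟨q⟩x` -/

/-- The coset `⟨q⟩x = {q^k x}`. [folklore] -/
private def lorbit (q x : G) : Set G := {y | ∃ j : ℤ, y = q ^ j * x}

/-- `⟨q⟩(q^k x) = ⟨q⟩x`. [folklore] -/
private theorem lorbit_zpow_mul (q x : G) (j : ℤ) : lorbit q (q ^ j * x) = lorbit q x := by
  ext y
  constructor
  · rintro ⟨i, rfl⟩
    exact ⟨i + j, by rw [zpow_add, mul_assoc]⟩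
  · rintro ⟨i, rfl⟩
    exact ⟨i - j, by rw [← mul_assoc, ← zpow_add, sub_add_cancel]⟩

/-- A chosen representative of the coset `⟨q⟩x` (the same for every element of the coset). [folklore] -/
private noncomputable def lrep (q x : G) : G := Classical.epsilon fun y => y ∈ lorbit q x

/-- The representative lies in the coset. [folklore] -/
private theorem lrep_mem (q x : G) : ∃ j : ℤ, lrep q x = q ^ j * x :=
  Classical.epsilon_spec (p := fun y => y ∈ lorbit q x) ⟨x, 0, by rw [zpow_zero, one_mul]⟩

/-- The representative only depends on the coset. [folklore] -/
private theorem lrep_zpow_mul (q x : G) (j : ℤ) : lrep q (q ^ j * x) = lrep q x := by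
  simp only [lrep, lorbit_zpow_mul]

/-- The representative only depends on the coset (`q⁻¹`-translate). [folklore] -/
private theorem lrep_inv_mul (q x : G) : lrep q (q⁻¹ * x) = lrep q x := by
  have h := lrep_zpow_mul q x (-1)
  rwa [zpow_neg_one] at h

/-- The representative only depends on the coset (`q^{-n}`-translate). [folklore] -/
private theorem lrep_pow_inv_mul (q x : G) (n : ℕ) : lrep q ((q ^ n)⁻¹ * x) = lrep q x := by
  have h := lrep_zpow_mul q x (-(n : ℤ))
  rwa [zpow_neg, zpow_natCast] at h

/-- For `q` of finite order `o`, every `x` is `q^j · lrep x` with `j < o`. [folklore] -/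
private theorem exists_lidx {q : G} (hq : IsOfFinOrder q) (x : G) :
    ∃ j, j < orderOf q ∧ x = q ^ j * lrep q x := by
  obtain ⟨i, hi⟩ := lrep_mem q x
  obtain ⟨n, hn⟩ := (hq.mem_powers_iff_mem_zpowers).2 (⟨-i, rfl⟩ : q ^ (-i) ∈ Subgroup.zpowers q)
  have hn' : q ^ n = q ^ (-i) := hn
  refine ⟨n % orderOf q, Nat.mod_lt _ hq.orderOf_pos, ?_⟩
  rw [pow_mod_orderOf, hn', hi, ← mul_assoc, ← zpow_add, neg_add_cancel, zpow_zero, one_mul]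

/-- The position `j < o` of `x` in its coset: `x = q^j · lrep x`. [folklore] -/
private noncomputable def lidx {q : G} (hq : IsOfFinOrder q) (x : G) : ℕ := Classical.choose (exists_lidx hq x)

/-- `lidx x < o`. [folklore] -/
private theorem lidx_lt {q : G} (hq : IsOfFinOrder q) (x : G) : lidx hq x < orderOf q :=
  (Classical.choose_spec (exists_lidx hq x)).1

/-- `x = q^{lidx x} · lrep x`. [folklore] -/
private theorem lidx_spec {q : G} (hq : IsOfFinOrder q) (x : G) : x = q ^ lidx hq x * lrep q x :=
  (Classical.choose_spec (exists_lidx hq x)).2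

/-- The position is unique below `o` (the action of `⟨q⟩` by left translation is free). [folklore] -/
private theorem lidx_unique {q : G} (hq : IsOfFinOrder q) {x : G} {j : ℕ} (hj : j < orderOf q)
    (h : x = q ^ j * lrep q x) : j = lidx hq x := by
  have h2 : q ^ j = q ^ lidx hq x := mul_right_cancel (h.symm.trans (lidx_spec hq x))
  rwa [pow_inj_mod, Nat.mod_eq_of_lt hj, Nat.mod_eq_of_lt (lidx_lt hq x)] at h2

/-- Stepping back inside a coset: position `j + 1 ↦ j`. [folklore] -/
private theorem lidx_inv_mul_of_succ {q : G} (hq : IsOfFinOrder q) {x : G} {j : ℕ} (h : lidx hq x = j + 1) :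
    lidx hq (q⁻¹ * x) = j := by
  symm
  apply lidx_unique hq
  · have := lidx_lt hq x
    omega
  · rw [lrep_inv_mul]
    have hs := lidx_spec hq x
    rw [h, pow_succ'] at hs
    conv_lhs => rw [hs]
    rw [mul_assoc, inv_mul_cancel_left]

/-- Stepping back from the representative lands at position `o - 1`. [folklore] -/
private theorem lidx_inv_mul_of_zero {q : G} (hq : IsOfFinOrder q) {x : G} (h : lidx hq x = 0) :
    lidx hq (q⁻¹ * x) = orderOf q - 1 := by
  symm
  apply lidx_unique hq
  · exact Nat.sub_one_lt hq.orderOf_pos.ne'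
  · rw [lrep_inv_mul]
    have hs := lidx_spec hq x
    rw [h, pow_zero, one_mul] at hs
    rw [← hs]
    congr 1
    rw [inv_eq_iff_mul_eq_one, ← pow_succ', Nat.sub_add_cancel hq.orderOf_pos, pow_orderOf_eq_one]

/-! ### `ker(N_q ·) = (1 - q) k[G]` and `Fix(q ·) = N_q k[G]` -/

/-- **`ker(N_q ·) = (1 - q)·k[G]`** (exactness of Brown's (6.3) at the `N`-arrow, for the left action of an
element `q` of finite order of an arbitrary group `G` on `k^G`): `N_q · f = 0` iff `f = γ - q·γ` for some `γ`.
[cite: Brown1982CohomologyGroups, Ch. I §6 (6.3)] -/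
theorem normL_eq_zero_iff {q : G} (hq : IsOfFinOrder q) (f : G → k) :
    normL q f = 0 ↔ ∃ γ : G → k, f = γ - lt q γ := by
  constructor
  · intro h
    -- the sum of `f` over every coset `⟨q⟩x` vanishes
    have horb : ∀ x, ∑ i ∈ Finset.range (orderOf q), f (q ^ i * x) = 0 := fun x => by
      have hx := congrFun h (q ^ (orderOf q - 1) * x)
      rw [normL_apply, Pi.zero_apply] at hx
      rw [← hx, ← Finset.sum_range_reflect]
      refine Finset.sum_congr rfl fun i hi => congrArg f ?_
      have hle : i ≤ orderOf q - 1 := Nat.le_sub_one_of_lt (Finset.mem_range.1 hi)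
      rw [← pow_mul_pow_sub q hle, mul_assoc, inv_mul_cancel_left]
    -- `γ` := the partial sums of `f` along each coset, starting at the representative
    refine ⟨fun x => ∑ i ∈ Finset.range (lidx hq x + 1), f (q ^ i * lrep q x), funext fun x => ?_⟩
    simp only [Pi.sub_apply, lt_apply]
    rw [lrep_inv_mul]
    have hs := lidx_spec hq x
    rcases hd : lidx hq x with _ | j
    · rw [hd, pow_zero, one_mul] at hs
      rw [lidx_inv_mul_of_zero hq hd, Nat.sub_add_cancel hq.orderOf_pos, horb, sub_zero,
        Finset.sum_range_succ, Finset.sum_range_zero, zero_add, pow_zero, one_mul, ← hs]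
    · rw [hd] at hs
      rw [lidx_inv_mul_of_succ hq hd, Finset.sum_range_succ_sub_sum, ← hs]
  · rintro ⟨γ, rfl⟩
    exact normL_sub_lt_self q γ

/-- **`Fix(q ·) = N_q·k[G]`** (exactness of Brown's (6.3) at the `(t-1)`-arrow): `q · f = f` iff
`f = N_q · γ` for some `γ`. [cite: Brown1982CohomologyGroups, Ch. I §6 (6.3)] -/
theorem lt_eq_self_iff {q : G} (hq : IsOfFinOrder q) (f : G → k) :
    lt q f = f ↔ ∃ γ : G → k, f = normL q γ := by
  classical
  constructor
  · intro h
    have h1 : ∀ x, f (q * x) = f x := fun x => by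
      have hx := congrFun h (q * x)
      rw [lt_apply, inv_mul_cancel_left] at hx
      exact hx.symm
    have hn : ∀ (n : ℕ) (x : G), f (q ^ n * x) = f x := by
      intro n
      induction n with
      | zero => intro x; rw [pow_zero, one_mul]
      | succ n ih => intro x; rw [pow_succ', mul_assoc, h1, ih]
    -- `γ` := `f` restricted to the set of representatives
    refine ⟨fun y => if lrep q y = y then f y else 0, funext fun x => ?_⟩
    simp only [normL_apply]
    have hs := lidx_spec hq x
    have hsum : ∀ i ∈ Finset.range (orderOf q),
        (if lrep q ((q ^ i)⁻¹ * x) = (q ^ i)⁻¹ * x then f ((q ^ i)⁻¹ * x) else 0) =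
          if i = lidx hq x then f (lrep q x) else 0 := by
      intro i hi
      rw [lrep_pow_inv_mul]
      by_cases hix : i = lidx hq x
      · have hA : (q ^ i)⁻¹ * x = lrep q x := by
          rw [inv_mul_eq_iff_eq_mul, hix]
          exact hs
        rw [if_pos hA.symm, if_pos hix, hA]
      · have hA : lrep q x ≠ (q ^ i)⁻¹ * x := fun hA =>
          hix (lidx_unique hq (Finset.mem_range.1 hi) (inv_mul_eq_iff_eq_mul.1 hA.symm))
        rw [if_neg hA, if_neg hix]
    rw [Finset.sum_congr rfl hsum, Finset.sum_ite_eq_of_mem' _ _ _ (Finset.mem_range.2 (lidx_lt hq x))]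
    conv_lhs => rw [hs]
    exact hn _ _
  · rintro ⟨γ, rfl⟩
    exact lt_normL q γ

/-! ### The right-handed versions, through `Gᵐᵒᵖ` -/

/-- `orderOf` is invariant under `MulOpposite.op`. [folklore] -/
private theorem orderOf_op (q : G) : orderOf (MulOpposite.op q) = orderOf q :=
  orderOf_eq_orderOf_iff.2 fun n => by rw [← MulOpposite.op_pow, MulOpposite.op_eq_one_iff]

/-- Finite order is invariant under `MulOpposite.op`. [folklore] -/
private theorem isOfFinOrder_op {q : G} (hq : IsOfFinOrder q) : IsOfFinOrder (MulOpposite.op q) := by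
  rw [← orderOf_pos_iff, orderOf_op]
  exact hq.orderOf_pos

omit [AddCommGroup k] in
/-- Right translation on `G` is left translation on `Gᵐᵒᵖ`. [folklore] -/
private theorem rt_eq_lt_op (h : G) (f : G → k) (x : G) :
    rt h f x = lt (MulOpposite.op h) (f ∘ MulOpposite.unop) (MulOpposite.op x) := by
  simp only [rt_apply, lt_apply, Function.comp_apply, ← MulOpposite.op_inv, ← MulOpposite.op_mul,
    MulOpposite.unop_op]

/-- The right norm on `G` is the left norm on `Gᵐᵒᵖ`. [folklore] -/
private theorem normR_eq_normL_op (q : G) (f : G → k) (x : G) :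
    normR q f x = normL (MulOpposite.op q) (f ∘ MulOpposite.unop) (MulOpposite.op x) := by
  simp only [normR_apply, normL_apply, orderOf_op, Function.comp_apply, ← MulOpposite.op_pow,
    ← MulOpposite.op_inv, ← MulOpposite.op_mul, MulOpposite.unop_op]

omit [Group G] [AddCommGroup k] in
/-- A function on `Gᵐᵒᵖ` re-read on `G` and back. [folklore] -/
private theorem comp_op_comp_unop (Γ : Gᵐᵒᵖ → k) : (Γ ∘ MulOpposite.op) ∘ MulOpposite.unop = Γ :=
  funext fun y => by simp only [Function.comp_apply, MulOpposite.op_unop]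

/-- **`ker(· N_q) = k[G]·(1 - q)`**: `f · N_q = 0` iff `f = γ - γ·q` for some `γ`.
[cite: Brown1982CohomologyGroups, Ch. I §6 (6.3)] -/
theorem normR_eq_zero_iff {q : G} (hq : IsOfFinOrder q) (f : G → k) :
    normR q f = 0 ↔ ∃ γ : G → k, f = γ - rt q γ := by
  refine ⟨fun h => ?_, ?_⟩
  · have h' : normL (MulOpposite.op q) (f ∘ MulOpposite.unop) = 0 := by
      funext y
      rw [Pi.zero_apply, ← MulOpposite.op_unop y, ← normR_eq_normL_op]
      exact congrFun h (MulOpposite.unop y)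
    obtain ⟨Γ, hΓ⟩ := (normL_eq_zero_iff (isOfFinOrder_op hq) _).1 h'
    refine ⟨Γ ∘ MulOpposite.op, funext fun x => ?_⟩
    have hx := congrFun hΓ (MulOpposite.op x)
    rw [Function.comp_apply, MulOpposite.unop_op, Pi.sub_apply] at hx
    rw [hx, Pi.sub_apply, rt_eq_lt_op, comp_op_comp_unop]
    rfl
  · rintro ⟨γ, rfl⟩
    exact normR_sub_rt_self q γ

/-- **`Fix(· q) = k[G]·N_q`**: `f · q = f` iff `f = γ · N_q` for some `γ`.
[cite: Brown1982CohomologyGroups, Ch. I §6 (6.3)] -/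
theorem rt_eq_self_iff {q : G} (hq : IsOfFinOrder q) (f : G → k) :
    rt q f = f ↔ ∃ γ : G → k, f = normR q γ := by
  refine ⟨fun h => ?_, ?_⟩
  · have h' : lt (MulOpposite.op q) (f ∘ MulOpposite.unop) = f ∘ MulOpposite.unop := by
      funext y
      rw [Function.comp_apply, ← MulOpposite.op_unop y, ← rt_eq_lt_op, MulOpposite.unop_op]
      exact congrFun h (MulOpposite.unop y)
    obtain ⟨Γ, hΓ⟩ := (lt_eq_self_iff (isOfFinOrder_op hq) _).1 h'
    refine ⟨Γ ∘ MulOpposite.op, funext fun x => ?_⟩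
    have hx := congrFun hΓ (MulOpposite.op x)
    rw [Function.comp_apply, MulOpposite.unop_op] at hx
    rw [hx, normR_eq_normL_op, comp_op_comp_unop]
  · rintro ⟨γ, rfl⟩
    exact rt_normR q γ

end Literature.GroupTheory.CombinatorialGroupTheory.FoxChain
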